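import Summits.CriticalPhenomena.SAWScalingLimit.Theorems.SAWLoopFugacityFlowAvoidanceLimitRingTwoSided
import Summits.CriticalPhenomena.SAWScalingLimit.Theorems.SAWLoopFugacityFlowAvoidanceLimitSidePotentials
import Summits.CriticalPhenomena.SAWScalingLimit.Theorems.SAWLoopFugacityFlowAvoidanceLimitNestedGermArcs
import Literature.Probability.LatticeModels.EdgeKilledBeurling
import Literature.Probability.LatticeModels.GermRegionLattice
import HarnessLib

/-!
# One-sidedness of a lateral side potential near an interior point of its arc

Sub-problem `CriticalPhenomena/SAWScalingLimit`, crux `AvoidanceLimit`, line `symplectic-fermion-anchor`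
(lead c7), stub `stub_germTwoSided`, hub existence (crux NOTES.md §"hcore blueprint (lead c6)" §7,
endpoint estimates of the TB-transversal). In the germ region `U' = germRegion D b s' g o` whose frontier is
`gateArc' ∪ D.boundary '' Icc σ' τ'`, fix a closed parameter window `[a₁, a₂] ⊆ [σ', τ']` and an interior
parameter `θ ∈ (a₁, a₂)`, `p = D.boundary θ`. Then for every `ε > 0` there is `ρ > 0` such that, eventually as
`δ → 0`, at every site `w` of `Θ' = germSites D b s' g o δ` within `ρ` of `p` the side potential of the arc
`A = D.boundary '' Icc a₁ a₂` is at least `1 - ε`: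
`killedPotential Ω^δ Θ' (sideSrc Ω^δ D δ A) w ≥ 1 - ε`.
Proof: the points of `∂D` near `p` have parameters near `θ` (`JordanDomain.exists_int_abs_sub_lt_of_dist_lt`),
so every non-kept edge at a site near `p` lands in `A` (`edgeLanding_mem_frontier_of_not_adj`); the exits of
`Θ'` lie within `δ` of the outer gate arc, which is at positive distance from `p` (it meets `∂D` only at
`D.boundary σ'`, `D.boundary τ'`); hence `1 - h_A(w) = edgeSurvive + h_{Aᶜ} ≤` probability of leaving a
ball about `p` alive (`one_sub_edgeSurvive_eq_potentials`, `killedPotential_sideSrc_compl_le_hitProb`),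
which the outward maneuver `JordanDomain.edgeKilled_survive_le_pow` about `p ∈ ∂D` makes `≤ ε`.

Contents: `exists_mem_gateArc_dist_le_of_adj` (a kept edge leaving `Θ_δ(s)` passes within `δ` of the
gate arc), the arithmetic of the outward maneuver about `p` (`arith_lateral`), and the estimate
`lateral_oneSided` with `ρ = min(m, d) / (400 · 5^J)`, `J = J(ε)`, `m` the inverse-continuity modulus of
the loop at tolerance `min(θ - a₁, a₂ - θ, 1/2)` and `d` the radius of a ball about `p` off the gate arc.

[cite: Chelkak2016, Lemma 3.4]
-/

noncomputable section

open scoped BigOperators Classical Topology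
open Set Metric Filter
open Literature.Topology.PlaneTopology
open Literature.Probability.LatticeModels
open Literature.Probability.RandomPlanarGeometry (JordanDomain)

namespace Summit.CriticalPhenomena.SAWScalingLimit.Theorems.AvoidanceLimit.Anchor

/-! ### Exits of the lattice germ region sit next to the gate arc -/

/-- **The kept edge into an exit meets the gate arc**: if a site `v` of `Θ_δ(s)` is joined by an
edge of `Ω_δ` to a site off `Θ_δ(s)`, some point of the gate arc is within `δ` of the mesh point
of `v` (the edge segment runs in `D̄` from `U(s)` to `D ∖ U(s)`, `exists_mem_gateArc_of_path`).
[cite: ChelkakWan2021, §3.2] -/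
theorem exists_mem_gateArc_dist_le_of_adj {D : JordanDomain} {b : ℂ} {s : ℝ} {hs : 0 < s}
    {g o : ℂ} {δ : ℝ} (h2 : TwoOff D (boxJD b hs))
    (hg : g ∈ D.carrier ∩ Literature.Topology.PlaneTopology.box b s) (ho : o ∈ D.carrier)
    (hoc : o ∉ closedBox b s) (hδ : 0 < δ) {v z : Site 2} (hv : v ∈ germSites D b hs g o δ)
    (hz : z ∉ germSites D b hs g o δ) (hadj : (discreteDomainGraph D.carrier δ).Adj v z) :
    ∃ q ∈ gateArc D (boxJD b hs) (germGateParam D b hs g o), dist (meshPoint δ v) q ≤ δ := by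
  obtain ⟨e, rfl⟩ := SRW.exists_dir_of_adj
    (meshGraph_le_zdGraph _ _ (discreteDomainGraph_le_meshGraph _ _ hadj))
  have hgq : g ∈ D.carrier \ gate D (boxJD b hs) (germGateParam D b hs g o) :=
    base_not_mem_gate hs hg _
  have hseg : segment ℝ (meshPoint δ v) (meshPoint δ (v + SRW.stepVec e)) ⊆ closure D.carrier :=
    (meshGraph_adj_iff.1 (discreteDomainGraph_adj_iff.1 hadj).1).2
  have hzD : meshPoint δ (v + SRW.stepVec e) ∈ D.carrier :=
    meshDomain_subset_meshVertices _ _ (discreteDomainGraph_adj_iff.1 hadj).2.2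
  have hzU : meshPoint δ (v + SRW.stepVec e) ∉ germRegion D b hs g o := fun h =>
    hz ⟨(discreteDomainGraph_adj_iff.1 hadj).2.2, h⟩
  have ht₀ : germGateParam D b hs g o ∈ gateParams D (boxJD b hs) :=
    (germGateParam_spec h2 hg ho hoc).1
  set γ : ℝ → ℂ := fun t =>
    AffineMap.lineMap (meshPoint δ v) (meshPoint δ (v + SRW.stepVec e)) t with hγ
  have hγc : ContinuousOn γ (Icc 0 1) := AffineMap.lineMap_continuous.continuousOn
  have hγseg : ∀ t ∈ Icc (0 : ℝ) 1,
      γ t ∈ segment ℝ (meshPoint δ v) (meshPoint δ (v + SRW.stepVec e)) := fun t ht => by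
    rw [segment_eq_image_lineMap]; exact ⟨t, ht, rfl⟩
  obtain ⟨t, ht, hp⟩ := exists_mem_gateArc_of_path h2 ht₀ hgq hγc
    (fun t ht => hseg (hγseg t ht))
    (by simp only [hγ, AffineMap.lineMap_apply_zero]; exact hv.2)
    (by simp only [hγ, AffineMap.lineMap_apply_one]; exact hzD)
    (by simp only [hγ, AffineMap.lineMap_apply_one]; exact hzU)
  refine ⟨γ t, hp, ?_⟩
  have hpp' : dist (meshPoint δ v) (meshPoint δ (v + SRW.stepVec e)) = δ :=
    (dist_meshPoint_add_stepVec δ v e).trans (abs_of_pos hδ)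
  have hball : segment ℝ (meshPoint δ v) (meshPoint δ (v + SRW.stepVec e)) ⊆
      closedBall (meshPoint δ v) δ :=
    (convex_closedBall _ δ).segment_subset (mem_closedBall_self hδ.le)
      (mem_closedBall.2 ((dist_comm _ _).trans hpp').le)
  exact mem_closedBall'.1 (hball (hγseg t ht))

/-- Arithmetic of the outward maneuver about the boundary point: the box of radius `48·5^J k`
about the rounded centre has all its mesh points within `3R/8` of the centre in each coordinate.
[folklore] -/
theorem arith_lateral {F δ ρ R kr : ℝ} (hF : 1 ≤ F) (hδ : 0 < δ) (hδρ : δ ≤ ρ)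
    (hρR : 400 * F * ρ = R) (hk : kr < ρ / δ + 2) :
    δ * (48 * (F * kr) + 1 / 2) < 3 * R / 8 := by
  have h1 : kr * δ < ρ + 2 * δ := by
    have := (lt_div_iff₀ hδ).1 (show kr - 2 < ρ / δ by linarith)
    linarith
  have h2 : F * (kr * δ) ≤ F * (ρ + 2 * δ) := mul_le_mul_of_nonneg_left h1.le (by linarith)
  have h3 : δ ≤ F * ρ := hδρ.trans (le_mul_of_one_le_left (by linarith) hF)
  have h4 : F * δ ≤ F * ρ := mul_le_mul_of_nonneg_left hδρ (by linarith)
  have e : δ * (48 * (F * kr) + 1 / 2) = 48 * (F * (kr * δ)) + δ / 2 := by ring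
  rw [e]
  nlinarith

/-! ### The endpoint estimate -/

/-- **A lateral side potential is close to `1` near an interior point of its arc.** See the module
docstring. [cite: Chelkak2016, Lemma 3.4] -/
theorem lateral_oneSided :
    ∀ ε : ℝ, 0 < ε → ∀ (D : JordanDomain) (b : ℂ) (s' : ℝ) (hs' : 0 < s') (g o : ℂ),
      TwoOff D (boxJD b hs') → g ∈ D.carrier ∩ Literature.Topology.PlaneTopology.box b s' → o ∈ D.carrier →
      o ∉ closedBox b s' →
    ∀ (σ' τ' : ℝ), σ' < τ' → τ' < σ' + 1 →
      frontier (germRegion D b hs' g o) =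
        gateArc D (boxJD b hs') (germGateParam D b hs' g o) ∪ D.boundary '' Set.Icc σ' τ' →
      ({D.boundary σ', D.boundary τ'} : Set ℂ) =
        {(boxJD b hs').boundary (gateLo D (boxJD b hs') (germGateParam D b hs' g o)),
         (boxJD b hs').boundary (gateHi D (boxJD b hs') (germGateParam D b hs' g o))} →
    ∀ (a₁ a₂ θ : ℝ), σ' ≤ a₁ → a₂ ≤ τ' → a₁ < θ → θ < a₂ →
    ∃ ρ : ℝ, 0 < ρ ∧ ∀ᶠ δ in 𝓝[>] (0 : ℝ), ∀ w ∈ germSites D b hs' g o δ,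
      dist (meshPoint δ w) (D.boundary θ) < ρ →
      1 - ε ≤ killedPotential (discreteDomainGraph D.carrier δ) (germSites D b hs' g o δ)
              (sideSrc (discreteDomainGraph D.carrier δ) D.carrier δ (D.boundary '' Set.Icc a₁ a₂)) w := by
  intro ε hε D b s' hs' g o h2' hg' ho hoc σ' τ' hστ hτσ _hfU' hends a₁ a₂ θ ha₁ ha₂ hθ₁ hθ₂
  -- (0) the constants: `J` annuli make the maneuver bound `≤ ε / 2`, `F = 5^J`
  have hq0 : 0 ≤ 1 - maneuverConst := by linarith [maneuverConst_le_one]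
  have hq1 : 1 - maneuverConst < 1 := by linarith [maneuverConst_pos]
  obtain ⟨J, hJ⟩ := exists_pow_lt_of_lt_one (show 0 < ε / 2 by positivity) hq1
  have houtJ : (1 - maneuverConst) ^ (J + 1) ≤ ε / 2 :=
    (pow_le_pow_of_le_one hq0 hq1.le (Nat.le_succ J)).trans hJ.le
  set F : ℝ := (5 : ℝ) ^ J with hF
  have hF1 : (1 : ℝ) ≤ F := one_le_pow₀ (by norm_num)
  have hF0 : (0 : ℝ) < F := one_pos.trans_le hF1
  -- (1a) separation: boundary points near `p = D.boundary θ` lie on the arc `A`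
  have hpfr : D.boundary θ ∈ frontier D.carrier := D.boundary_mem_frontier θ
  have hpD : D.boundary θ ∉ D.carrier := fun h => by
    have : D.boundary θ ∈ D.carrier ∩ frontier D.carrier := ⟨h, hpfr⟩
    rw [D.isOpen.inter_frontier_eq] at this
    exact this
  obtain ⟨m, hm, hnear⟩ := D.exists_int_abs_sub_lt_of_dist_lt
    (τ := min (min (θ - a₁) (a₂ - θ)) (1 / 2))
    (lt_min (lt_min (by linarith) (by linarith)) (by norm_num)) (min_le_right _ _)
  have hAnear : ∀ q ∈ frontier D.carrier, dist q (D.boundary θ) < m →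
      q ∈ D.boundary '' Icc a₁ a₂ := by
    intro q hq hqp
    rw [← D.range_boundary] at hq
    obtain ⟨φ, rfl⟩ := hq
    obtain ⟨k, hk⟩ := hnear θ φ (by rwa [dist_comm])
    have hk' := abs_lt.1 hk
    have hτ1 : min (min (θ - a₁) (a₂ - θ)) (1 / 2) ≤ θ - a₁ :=
      (min_le_left _ _).trans (min_le_left _ _)
    have hτ2 : min (min (θ - a₁) (a₂ - θ)) (1 / 2) ≤ a₂ - θ :=
      (min_le_left _ _).trans (min_le_right _ _)
    refine ⟨φ - k, ⟨by linarith [hk'.1], by linarith [hk'.2]⟩, ?_⟩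
    rw [show φ - (k : ℝ) = φ - (k : ℤ) * (1 : ℝ) by ring]
    exact D.periodic_boundary.sub_int_mul_eq k
  -- (1b) `p` is off the (closed) outer gate arc: a ball about `p` misses it
  have hpG : D.boundary θ ∉ gateArc D (boxJD b hs') (germGateParam D b hs' g o) := by
    intro hpG'
    have hpends : D.boundary θ ∉
        ({(boxJD b hs').boundary (gateLo D (boxJD b hs') (germGateParam D b hs' g o)),
          (boxJD b hs').boundary (gateHi D (boxJD b hs') (germGateParam D b hs' g o))} : Set ℂ) := by
      rw [← hends]
      rintro (h | h)
      · have := D.injOn_boundary_Ico σ' ⟨by linarith, by linarith⟩ ⟨le_rfl, by linarith⟩ h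
        linarith
      · have := D.injOn_boundary_Ico σ' ⟨by linarith, by linarith⟩ ⟨hστ.le, hτσ⟩ h
        linarith
    have : D.boundary θ ∈ gate D (boxJD b hs') (germGateParam D b hs' g o) := by
      rw [gate_eq_gateArc_diff h2']; exact ⟨hpG', hpends⟩
    exact hpD (gate_subset_carrier _ this)
  obtain ⟨d, hd, hball⟩ := Metric.isOpen_iff.1
    (isClosed_gateArc (D := D) (Q := boxJD b hs') (germGateParam D b hs' g o)).isOpen_compl
    (D.boundary θ) hpG
  have hfar : ∀ z ∈ gateArc D (boxJD b hs') (germGateParam D b hs' g o),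
      d ≤ dist z (D.boundary θ) := fun z hz => by
    by_contra h
    exact hball (mem_ball.2 (not_le.1 h)) hz
  -- the macroscopic radius `R` and the answer `ρ = R / (400 F)`
  set R : ℝ := min m d with hR
  have hR0 : 0 < R := lt_min hm hd
  have hRm : R ≤ m := min_le_left _ _
  have hRd : R ≤ d := min_le_right _ _
  refine ⟨R / (400 * F), by positivity, ?_⟩
  set ρ : ℝ := R / (400 * F) with hρ
  have hρ0 : 0 < ρ := by positivity
  have hρR : 400 * F * ρ = R := by rw [hρ]; field_simp
  have hρR' : ρ ≤ R / 400 := by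
    rw [div_le_div_iff₀ (by positivity) (by norm_num)]
    nlinarith
  filter_upwards [eventually_mem_nhdsWithin, (eventually_lt_nhds hρ0).filter_mono nhdsWithin_le_nhds]
    with δ hδ hδρ
  replace hδ : 0 < δ := hδ
  intro w hw hwp
  set Gr := discreteDomainGraph D.carrier δ
  set Θ' := germSites D b hs' g o δ
  set A : Set ℂ := D.boundary '' Icc a₁ a₂ with hA
  have hΘ'fin : Θ'.Finite := germSites_finite hδ
  -- (2) the lattice centre `c ≈ p/δ` and scale `k ≈ ρ/δ`
  obtain ⟨c, hc0, hc1⟩ : ∃ c : Site 2, |(D.boundary θ).re / δ - c 0| ≤ 1 / 2 ∧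
      |(D.boundary θ).im / δ - c 1| ≤ 1 / 2 :=
    ⟨_, abs_div_sub_nearestSite_le δ (D.boundary θ)⟩
  obtain ⟨k, hk0, hkr1, hkr2⟩ : ∃ k : ℕ, 0 < k ∧ ρ / δ + 1 ≤ k ∧ (k : ℝ) < ρ / δ + 2 :=
    ⟨⌈ρ / δ⌉₊ + 1, Nat.succ_pos _, by push_cast; linarith [Nat.le_ceil (ρ / δ)],
      by push_cast; linarith [Nat.ceil_lt_add_one (show 0 ≤ ρ / δ by positivity)]⟩
  have hkr0 : (1 : ℝ) ≤ k := by exact_mod_cast hk0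
  have hpk0 : |(D.boundary θ).re / δ - c 0| < 12 * k := hc0.trans_lt (by linarith)
  have hpk1 : |(D.boundary θ).im / δ - c 1| < 12 * k := hc1.trans_lt (by linarith)
  -- `w ∈ mB c k`
  have hwmB : w ∈ mB c k := by
    have hn : ‖meshPoint δ w - D.boundary θ‖ < ρ := by rwa [← dist_eq_norm]
    have e0 : |δ * (w 0 : ℝ) - (D.boundary θ).re| ≤ ρ := by
      rw [← meshPoint_re, ← Complex.sub_re]; exact (Complex.abs_re_le_norm _).trans hn.le
    have e1 : |δ * (w 1 : ℝ) - (D.boundary θ).im| ≤ ρ := by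
      rw [← meshPoint_im, ← Complex.sub_im]; exact (Complex.abs_im_le_norm _).trans hn.le
    have hρδ : ρ / δ + 1 / 2 ≤ 12 * k := by linarith
    exact ⟨by exact_mod_cast (abs_sub_le_of_mesh hδ hc0 e0).trans hρδ,
      by exact_mod_cast (abs_sub_le_of_mesh hδ hc1 e1).trans hρδ⟩
  -- the big box `W`: all its mesh points are within `3R/4` of `p`
  set W : Set (Site 2) := mW c (5 ^ J * k)
  have hWfin : W.Finite := mW_finite c _
  have key : δ * (48 * (F * k) + 1 / 2) < 3 * R / 8 := arith_lateral hF1 hδ hδρ.le hρR hkr2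
  have hWnear : ∀ x ∈ W, dist (meshPoint δ x) (D.boundary θ) < 3 * R / 4 := by
    rintro x ⟨hx0, hx1⟩
    have hx0' : |(x 0 : ℝ) - c 0| ≤ 48 * (F * k) := by
      rw [hF]; exact_mod_cast hx0
    have hx1' : |(x 1 : ℝ) - c 1| ≤ 48 * (F * k) := by
      rw [hF]; exact_mod_cast hx1
    have f0 : |(meshPoint δ x - D.boundary θ).re| < 3 * R / 8 := by
      rw [Complex.sub_re, meshPoint_re]
      exact ((abs_mesh_coord hδ hc0 (x 0)).2.trans
        (mul_le_mul_of_nonneg_left (add_le_add hx0' le_rfl) hδ.le)).trans_lt key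
    have f1 : |(meshPoint δ x - D.boundary θ).im| < 3 * R / 8 := by
      rw [Complex.sub_im, meshPoint_im]
      exact ((abs_mesh_coord hδ hc1 (x 1)).2.trans
        (mul_le_mul_of_nonneg_left (add_le_add hx1' le_rfl) hδ.le)).trans_lt key
    rw [dist_eq_norm]
    linarith [Complex.norm_le_abs_re_add_abs_im (meshPoint δ x - D.boundary θ)]
  have hδR : δ < R / 4 := by linarith
  -- (2ii) inside `W`, the walk of `Θ'` can only leave `Θ'` by leaving `W` (exits sit by the gate arc)
  have hclosed : ∀ v ∈ Θ' ∩ W, ∀ z ∈ W, Gr.Adj v z → z ∈ Θ' := by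
    intro v hv z _ hadj
    by_contra hzΘ
    obtain ⟨q, hq, hvq⟩ := exists_mem_gateArc_dist_le_of_adj h2' hg' ho hoc hδ hv.1 hzΘ hadj
    have h1 := hfar q hq
    have h2 := hWnear v hv.2
    have h3 := dist_triangle_left q (D.boundary θ) (meshPoint δ v)
    linarith
  -- (2i) inside `W`, every fatal edge lands on `A`
  have hY : ∀ y ∈ Θ', ∀ e : SRW.Dir 2, landsIn Gr D.carrier δ (A ∪ ∅)ᶜ y e → y ∈ Θ' \ W := by
    intro y hy e hland
    refine ⟨hy, fun hyW => hland.2 (Or.inl ?_)⟩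
    refine hAnear _ (edgeLanding_mem_frontier_of_not_adj D.isOpen hy.1 hland.1) ?_
    have h1 : dist (meshPoint δ y) (edgeLanding D.carrier δ y e) ≤ δ :=
      dist_meshPoint_edgeLanding_le hδ.le
    have h2 := hWnear y hyW
    have h3 := dist_triangle_left (edgeLanding D.carrier δ y e) (D.boundary θ) (meshPoint δ y)
    linarith
  -- (3) side-potential bookkeeping
  have step1 := one_sub_le_sidePotentials Gr D.carrier δ Θ' hΘ'fin A ∅ (disjoint_empty A) (Θ' \ W)
    hY w hw
  have hΦ0 : killedPotential Gr Θ' (sideSrc Gr D.carrier δ ∅) w = 0 := by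
    rw [killedPotential_eq_sum_of_forall_mem ∅ (fun y _ h => ?_), Finset.sum_empty]
    exact (h (sideSrc_eq_zero_of_forall_not_landsIn fun e he => (mem_empty_iff_false _).1 he.2)).elim
  -- (4) both error terms are dominated by survival in `W`: outward maneuver about `p`
  have hwW : w ∈ Θ' ∩ W :=
    ⟨hw, mB_subset_mW (mB_subset_mB_of_le c (Nat.le_mul_of_pos_left k (pow_pos (by norm_num) J)) hwmB)⟩
  have hsurvW : edgeSurvive Gr W w ≤ ε / 2 :=
    (D.edgeKilled_survive_le_pow hδ hpfr J c k hk0 hpk0 hpk1 w hwmB).trans houtJ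
  have hsurv : edgeSurvive Gr Θ' w ≤ ε / 2 :=
    (le_edgeSurvive_of_closed hΘ'fin hWfin hclosed
      ((killedHarmExt_harmonicOn hΘ'fin _).mono inter_subset_left)
      (fun z => (edgeSurvive_mem_Icc hΘ'fin z).2) w hwW).trans hsurvW
  have hhit : hitProb Gr Θ' (Θ' \ W) w ≤ ε / 2 :=
    (le_edgeSurvive_of_closed hΘ'fin hWfin hclosed
      ((hitProb_harmonicOn hΘ'fin).mono fun z hz => ⟨hz.1, fun hzY => hzY.2 hz.2⟩)
      (fun z => hitProb_le_one hΘ'fin z) w hwW).trans hsurvW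
  linarith

end Summit.CriticalPhenomena.SAWScalingLimit.Theorems.AvoidanceLimit.Anchor

end
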